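import Summits.ValiantsHypothesis.ValiantsHypothesis.Theses.ProofCarryingSymmetry
import Literature.Computability.AlgebraicComplexity.SymmetricDetCircuitEval
import HarnessLib

/-!
# ValiantsHypothesis / ProofCarryingSymmetry — `DetCalibration` (stmt-ValiantsHypothesis-10344)

Route `ValiantsHypothesis/ProofCarryingSymmetry`, support item `DetCalibration` (rank 9,
CALIBRATION / NON-VACUITY): `det_n` has `S_n`-symmetric labelled arithmetic circuits over `ℂ`
(diagonal action `x_ij ↦ x_{σ i σ j}`, single fixed output) of size polynomial in `n` — here
`≤ (n + 2)⁴`, exponent `c = 4`. This is Dawar–Wilsenach 2025, Thm. 4.1 (Le Verrier's method), carried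
out in the tree as `Literature.Computability.AlgebraicComplexity.leVerrierCircuit` (the
Faddeev–LeVerrier recursion `N_{l-1} = M N_l + c_l 1`, `c_l = −tr(M N_l)/(n − l)` on `M = −X`, output
`c_0 = det X`; symmetric because `S_n` merely relabels the indices of the gates; correctness
`eval_output_leVerrierCircuit`, size `card_leVerrierGate_le`). Pure bookkeeping on top of
`exists_isSymmetric_circuit_detPoly`.
-/

-- `Summit.ValiantsHypothesis.ValiantsHypothesis.…` is the tree's mandated single-conjunct layout
-- (Sub = Summit), so the duplicated namespace component is intended.
set_option linter.dupNamespace false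

namespace Summit.ValiantsHypothesis.ValiantsHypothesis.Theorems

open Literature.Computability.AlgebraicComplexity

/-- Settles `stmt-ValiantsHypothesis-10344` (support `DetCalibration` of route ProofCarryingSymmetry):
there is `c` (namely `4`) such that for every `n` the generic determinant `det_n` is computed by an
`S_n`-symmetric labelled arithmetic circuit over `ℂ` with at most `(n + 2)^c` gates — Le Verrier's
circuit (Dawar–Wilsenach 2025, Thm. 4.1; tree `leVerrierCircuit`,
`exists_isSymmetric_circuit_detPoly`). [cite: DawarWilsenach2025, Thm. 4.1] -/
theorem detCalibration_proof :
    Summit.ValiantsHypothesis.ValiantsHypothesis.Theses.ProofCarryingSymmetry.DetCalibration := by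
  unfold Summit.ValiantsHypothesis.ValiantsHypothesis.Theses.ProofCarryingSymmetry.DetCalibration
  exact ⟨4, fun n => exists_isSymmetric_circuit_detPoly ℂ n⟩

end Summit.ValiantsHypothesis.ValiantsHypothesis.Theorems
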